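/-
Copyright (c) 2026 the pub-hodgecm-mathlib formalisation cell (harness21).  Prover seat hodgecm-mathlib-LH4-p01 (g10): road M6 → F3 «TOT-Λ BY OVER-ORDERS» (LEAD F0P3a-plan
T14-66), carve (c5-ii) «MODEL PACKAGE SELECTION» FILE D «THE TYPE-(2) PAIR OF THE EISENSTEIN DATA» (F3-5 pen LH7-p04 (g12) 01:08:48Z «= FILE D»); 2026-09-03.
-/
import Literature.NumberTheory.Automorphic.EigenUniformiserCoordinates        -- ★ (ζ1) p853151 (LH10-p01 (g11)): `exists_coord_of_eigenUniformiser`, `exists_coord_eigenvalue_of_rel`, `eigenUniformiser_isRoot_of_isRoot`, `mem_integer_of_eigenUniformiser`; brings ★ (c6) FILE 1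
import Literature.NumberTheory.Automorphic.GluedOverOrderOfUnitaryPair          -- ★ (c6) FILE 2 p853079 (this seat): `exists_coe_range_eval₂_eq_glued_map`
import Literature.NumberTheory.Rogawski1990.EndoscopicBlockFrameBridgeInputs    -- ★ (c5-i) p853057 (LH10-p01 (g10)): `det_smul_one_sub_eq`
import HarnessLib

/-!
# The type-(2) pair of the Eisenstein data: from ★ (W1)'s `(g, u, Θ, α, β, a, b, n′, N′)` and a unitary root `λ` of `χ_g` to ★ (c6)'s binders `(u, λ = jO p + jO q θ)`,
# `hlam2`, `hxstar`, `hN`, `hn` — and the glued type-(2) order `𝒪_E[(u, λ)] = G(N′, n′, ιO y)`  (Rogawski 1990 §4.9; Neukirch I §12; Serre I §6)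

Topic `NumberTheory/Automorphic`; namespace `Literature.NumberTheory.Automorphic`.  THEOREMS ONLY (no definition, no instance, no notation, no named fact, no `sorry`); kernel lane
`--supports stmt-HodgeConjecture-24833`.  Cell `pub/hodgecm-mathlib` (D-0151), crux H413 = `stmt-HodgeConjecture-24833`; road M6 → F3 «TOT-Λ by over-orders» (route (B));
carve **(c5-ii) FILE D** = SIG (c5-ii) v1 §2 «the Θ̃-link» TYPED (F3-5b-III rows `xR ∕ hxR ∕ cF ∕ hR ∕ hlaw`): in the ABSTRACT valued frame of ★ (ζ1) `EigenUniformiserCoordinates`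
(`E ⊂ K` valued fields, `hval`, `jO` over `algebraMap`, the Eisenstein basis `(1, θ)` of `𝒪_K`, `θ² = jO a·θ + jO k`, `a ∈ 𝔪`, `|k| = |ϖ|`, `hcoord`), GIVEN ★ (W1)
`ncard_vertex_rowZero_eq_of_total`'s `hT` data read in `valuation`-currency — `g ∈ M₂(𝒪_E)`, `u ∈ 𝒪_E`, `Θ = α•1 + β•g` with `|det Θ| = |ϖ|`, `|tr Θ| < 1`,
`u•1 − g = a•1 + b•Θ`, `|det(u•1 − g)| = |ϖ|^{n′}`, `|b| = |ϖ|^{N′}`, `g₁₀ ≠ 0` (★ (c5-i) (E)) — and a root `λ ∈ K` of `χ_g` that is UNITARY together with `u` for `⋆ = (σ, σ_K)`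
(`u·σu = 1`, `λ·σ_Kλ = 1`; integral involutions `σO σKO` over `σ σ_K`), THIS FILE produces ★ (c6) `exists_coe_range_eval₂_eq_glued(_map)`'s binders VERBATIM: integral
`uO tO DO` over `u, tr g, det g`, the Eisenstein coordinates `λ = jO pO + jO qO·θ`, the quadratic relation `hlam2`, the unitarity `hxstar`, `hN : |qO| = |ϖ|^{N′}`,
`hn : |uO² − tO·uO + DO| = |ϖ|^{n′}` (§2); and, over the inert dictionary `ιO σO` of ★ F3-3 ∕ ★ (c5-ii) A, the COMPOSED head `𝒪_E[(uO, λ)] = G(N′, n′, ιO y)` with `y ∈ 𝒪_F` at a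
monogenic level (★ (c6) FILE 2) (§3).  The heavy lifting is ★ (ζ1) (LH10-p01 (g11)): Θ̃ = α + βλ is a root of χ_Θ (ζ1c), integral with θ-coordinate a UNIT (ζ1a), and
`λ = jO(u − a − b·p₀) + jO(−b·q₀)·θ` (ζ1b); this file supplies the matrix bookkeeping `bβ = −1`, `a = u − bα` (from `u•1 − g = a•1 + b•Θ` at the entries `(1,0)`, `(0,0)`,
`g₁₀ ≠ 0`), the integrality of `a` (`bα = bΘ̃ + λ ∈ 𝒪_K ∩ E`), and the transport to integer rings.
HONEST LABEL: HC_CM is proved only modulo the 7 printed citations (2 remaining named inputs: hLiu418 = stmt-HodgeConjecture-24832, h413 = stmt-HodgeConjecture-24833) until rung 0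
closes; valued linear algebra, count-neutral (pays no organ, opens no road; zero label movement until F5 ★ + a desk-priced rider).
[cite: Rogawski1990, §4.9 Lemma 4.9.3 p. 56, Prop. 4.9.1 (b) p. 55] [cite: Neukirch1999, Ch. I §12; Ch. II §4–§5] [cite: SerreLocalFields1979, Ch. I §6 Prop. 17–18]

* §1 `mul_eq_neg_one_and_eq_of_rel` (`bβ = −1`, `a = u − bα`), `trace_fin_two_mem_integer`, `det_fin_two_mem_integer`;
* §2 **`exists_integralPair_of_eisensteinData`** (★ (c6)'s binders from ★ (W1)'s data);
* §3 **`exists_typeTwoOrder_of_eisensteinData`** (composed with ★ (c6) FILE 2: `𝒪_E[(u, λ)] = G(N′, n′, ιO y)`, `y` at a monogenic level, `M = 0` allowed).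

## References
* [Rogawski1990] J. D. Rogawski, *Automorphic Representations of Unitary Groups in Three Variables*, Ann. of Math. Stud. 123 (1990): §4.9 Lemma 4.9.3 p. 56, Prop. 4.9.1 (b) p. 55.
* [Neukirch1999] J. Neukirch, *Algebraic Number Theory*, Grundlehren 322 (1999): Ch. I §12 (orders); Ch. II §4–§5 (valued fields, integers).
* [SerreLocalFields1979] J.-P. Serre, *Local Fields*, GTM 67 (1979): Ch. I §6 Prop. 17–18 (Eisenstein bases).
-/

set_option autoImplicit false

noncomputable section

open scoped ValuativeRel
open ValuativeRel Matrix

namespace Literature.NumberTheory.Automorphic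

/-! ## §1 Matrix bookkeeping and integrality of trace ∕ determinant -/

/-- **`bβ = −1` AND `a = u − bα`** from `u•1 − g = a•1 + b•(α•1 + β•g)` for a non-scalar `g` (`g₁₀ ≠ 0`): compare the `(1,0)` and `(0,0)` entries. [cite: Rogawski1990, §4.9 p. 55] -/
theorem mul_eq_neg_one_and_eq_of_rel {E : Type*} [Field E] {g : Matrix (Fin 2) (Fin 2) E} {u α β a b : E} (h10 : g 1 0 ≠ 0)
    (hrel : u • (1 : Matrix (Fin 2) (Fin 2) E) - g = a • 1 + b • (α • 1 + β • g)) : b * β = -1 ∧ a = u - b * α := by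
  have e10 := congrFun (congrFun hrel 1) 0
  have e00 := congrFun (congrFun hrel 0) 0
  simp only [Matrix.sub_apply, Matrix.add_apply, Matrix.smul_apply, Matrix.one_apply_ne (by decide : (1 : Fin 2) ≠ 0), Matrix.one_apply_eq,
    smul_eq_mul, mul_zero, zero_sub, mul_one, zero_add] at e10 e00
  have hbβ : b * β = -1 := by
    have h : (b * β + 1) * g 1 0 = 0 := by linear_combination e10.symm
    rcases mul_eq_zero.1 h with h1 | h1
    · linear_combination h1
    · exact absurd h1 h10
  exact ⟨hbβ, by linear_combination (-1 : E) * e00 - g 0 0 * hbβ⟩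

/-- The trace of an integral 2×2 matrix is integral. [cite: Neukirch1999, Ch. II §4] -/
theorem trace_fin_two_mem_integer {E : Type*} [Field E] [ValuativeRel E] {g : Matrix (Fin 2) (Fin 2) E} (hg : ∀ i j, g i j ∈ 𝒪[E]) : g.trace ∈ 𝒪[E] := by
  rw [Matrix.trace_fin_two]; exact add_mem (hg 0 0) (hg 1 1)

/-- The determinant of an integral 2×2 matrix is integral. [cite: Neukirch1999, Ch. II §4] -/
theorem det_fin_two_mem_integer {E : Type*} [Field E] [ValuativeRel E] {g : Matrix (Fin 2) (Fin 2) E} (hg : ∀ i j, g i j ∈ 𝒪[E]) : g.det ∈ 𝒪[E] := by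
  rw [Matrix.det_fin_two]; exact sub_mem (mul_mem (hg 0 0) (hg 1 1)) (mul_mem (hg 0 1) (hg 1 0))

/-! ## §2 The integral pair `(u, λ = jO p + jO q θ)` with ★ (c6)'s binders -/

section Pair

variable {E : Type*} [Field E] [ValuativeRel E] {K : Type*} [Field K] [ValuativeRel K] [Algebra E K]
  (hval : ∀ x : E, valuation K (algebraMap E K x) ≤ 1 ↔ valuation E x ≤ 1)
  (jO : 𝒪[E] →+* 𝒪[K]) (hjO : ∀ x : 𝒪[E], ((jO x : 𝒪[K]) : K) = algebraMap E K x)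
  (θ : 𝒪[K]) {aE kE : 𝒪[E]} (hθ : θ ^ 2 = jO aE * θ + jO kE) (ha : aE ∈ IsLocalRing.maximalIdeal 𝒪[E])
  {ϖ : E} (hϖ : IsUniformizingElement ϖ) (hk₁ : valuation E (kE : E) = valuation E ϖ)
  (hcoord : ∀ z : 𝒪[K], ∃! bc : 𝒪[E] × 𝒪[E], z = jO bc.1 + jO bc.2 * θ)
  (σ : E →+* E) (σK : K →+* K) (σO : 𝒪[E] →+* 𝒪[E]) (hσO : ∀ x : 𝒪[E], ((σO x : 𝒪[E]) : E) = σ x)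
  (σKO : 𝒪[K] →+* 𝒪[K]) (hσKO : ∀ z : 𝒪[K], ((σKO z : 𝒪[K]) : K) = σK z)

include hval hjO hθ ha hϖ hk₁ hcoord hσO hσKO in
/-- **(c5-ii-D) THE TYPE-(2) PAIR OF THE EISENSTEIN DATA.**  In ★ (ζ1)'s valued frame, from ★ (W1)'s `hT` data (`g` integral, non-scalar via `g₁₀ ≠ 0`; `u` integral; `Θ = α•1 + β•g`
with `|det Θ| = |ϖ|`, `|tr Θ| < 1`; `u•1 − g = a•1 + b•Θ`; `|det(u•1 − g)| = |ϖ|^n`; `|b| = |ϖ|^N`) and a root `λ ∈ K` of `χ_g` with `u·σu = 1`, `λ·σ_Kλ = 1`: there are integral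
`uO pO qO tO DO` over `u`, ·, ·, `tr g`, `det g` with `λ = jO pO + jO qO·θ` and ★ (c6) `exists_coe_range_eval₂_eq_glued(_map)`'s four binders `hlam2 hxstar hN hn` VERBATIM.
[cite: Rogawski1990, §4.9 Lemma 4.9.3 p. 56] [cite: Neukirch1999, Ch. I §12] [cite: SerreLocalFields1979, Ch. I §6 Prop. 17–18] -/
theorem exists_integralPair_of_eisensteinData
    {g Θ : Matrix (Fin 2) (Fin 2) E} {u α β a b : E} {n N : ℕ}
    (hg : ∀ i j, g i j ∈ 𝒪[E]) (hu : u ∈ 𝒪[E]) (h10 : g 1 0 ≠ 0)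
    (hΘ : Θ = α • 1 + β • g) (hΘd : valuation E Θ.det = valuation E ϖ) (hΘt : valuation E Θ.trace < 1)
    (hrel : u • (1 : Matrix (Fin 2) (Fin 2) E) - g = a • 1 + b • Θ)
    (hn : valuation E (u • (1 : Matrix (Fin 2) (Fin 2) E) - g).det = valuation E ϖ ^ n) (hb : valuation E b = valuation E ϖ ^ N)
    {lam : K} (hlam : lam ^ 2 - algebraMap E K g.trace * lam + algebraMap E K g.det = 0)
    (hσu : u * σ u = 1) (hσlam : lam * σK lam = 1) :
    ∃ uO pO qO tO DO : 𝒪[E], (uO : E) = u ∧ (tO : E) = g.trace ∧ (DO : E) = g.det ∧ ((jO pO + jO qO * θ : 𝒪[K]) : K) = lam ∧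
      (jO pO + jO qO * θ) ^ 2 - jO tO * (jO pO + jO qO * θ) + jO DO = 0 ∧
      ((uO, jO pO + jO qO * θ) : 𝒪[E] × 𝒪[K]) * RingHom.prodMap σO σKO (uO, jO pO + jO qO * θ) = 1 ∧
      valuation E ((qO : 𝒪[E]) : E) = valuation E ϖ ^ N ∧
      valuation E ((uO * uO - tO * uO + DO : 𝒪[E]) : E) = valuation E ϖ ^ n := by
  subst hΘ
  -- ### 1. the matrix bookkeeping `bβ = −1`, `a = u − bα`, and the relation read on the root `λ`
  obtain ⟨hbβ, hau⟩ := mul_eq_neg_one_and_eq_of_rel h10 hrel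
  set Θt : K := algebraMap E K α + algebraMap E K β * lam with hΘtdef
  have hrelK : algebraMap E K u - lam = algebraMap E K a + algebraMap E K b * Θt := by
    have hbβK : algebraMap E K b * algebraMap E K β = -1 := by rw [← map_mul, hbβ, map_neg, map_one]
    rw [hΘtdef, hau, map_sub, map_mul]
    linear_combination (-lam) * hbβK
  -- ### 2. Θ̃ is a root of `χ_Θ` (★ (ζ1c)), with integral trace ∕ determinant data
  have hΘtroot := eigenUniformiser_isRoot_of_isRoot g hlam α β
  have htrO : (α • (1 : Matrix (Fin 2) (Fin 2) E) + β • g).trace ∈ 𝒪[E] := (Valuation.mem_integer_iff _ _).2 hΘt.le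
  have hdetO : (α • (1 : Matrix (Fin 2) (Fin 2) E) + β • g).det ∈ 𝒪[E] := (Valuation.mem_integer_iff _ _).2 (hΘd ▸ hϖ.valuation_le_one)
  have hΘt' : Θt ^ 2 - algebraMap E K ((⟨_, htrO⟩ : 𝒪[E]) : E) * Θt + algebraMap E K ((⟨_, hdetO⟩ : 𝒪[E]) : E) = 0 := hΘtroot
  obtain ⟨hΘO, p₀, q₀, hΘcoord, hq₀, -⟩ := exists_coord_of_eigenUniformiser hval hϖ hΘt' hΘt hΘd jO hjO θ hθ ha hk₁ hcoord
  -- ### 3. integrality of `u`, `b`, `a`, `tr g`, `det g`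
  have hbO : b ∈ 𝒪[E] := (Valuation.mem_integer_iff _ _).2 (by rw [hb]; exact pow_le_one₀ zero_le hϖ.valuation_le_one)
  have htO : g.trace ∈ 𝒪[E] := trace_fin_two_mem_integer hg
  have hDO : g.det ∈ 𝒪[E] := det_fin_two_mem_integer hg
  have hlamO : lam ∈ 𝒪[K] :=
    mem_integer_of_eigenUniformiser hval (Θt := lam) (tΘ := ⟨_, htO⟩) (dΘ := ⟨_, hDO⟩) hlam
  have haO : a ∈ 𝒪[E] := by
    -- `bα = bΘ̃ + λ` is integral in `K`, hence in `E`
    have hbα : algebraMap E K (b * α) = algebraMap E K b * Θt + lam := by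
      have hbβK : algebraMap E K b * algebraMap E K β = -1 := by rw [← map_mul, hbβ, map_neg, map_one]
      rw [hΘtdef, map_mul]
      linear_combination (-lam) * hbβK
    have hbαK : algebraMap E K (b * α) ∈ 𝒪[K] := by
      rw [hbα]
      exact add_mem (mul_mem (by simpa [hjO] using (jO ⟨b, hbO⟩).2) hΘO) hlamO
    have hbαE : b * α ∈ 𝒪[E] := (Valuation.mem_integer_iff _ _).2 ((hval _).1 ((Valuation.mem_integer_iff _ _).1 hbαK))
    rw [hau]
    exact sub_mem hu hbαE
  -- ### 4. ★ (ζ1b): the Eisenstein coordinates of `λ`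
  have hrelO : algebraMap E K ((⟨u, hu⟩ : 𝒪[E]) : E) - lam = algebraMap E K ((⟨a, haO⟩ : 𝒪[E]) : E) + algebraMap E K ((⟨b, hbO⟩ : 𝒪[E]) : E) * Θt := hrelK
  obtain ⟨hlamO', hlamcoord, hvq⟩ := exists_coord_eigenvalue_of_rel jO hjO θ hΘO hΘcoord hq₀ hrelO
  set uO : 𝒪[E] := ⟨u, hu⟩ with huO
  set tO : 𝒪[E] := ⟨g.trace, htO⟩ with htOdef
  set DO : 𝒪[E] := ⟨g.det, hDO⟩ with hDOdef
  set pO : 𝒪[E] := ⟨u, hu⟩ - ⟨a, haO⟩ - ⟨b, hbO⟩ * p₀ with hpO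
  set qO : 𝒪[E] := -(⟨b, hbO⟩ * q₀) with hqO
  set L : 𝒪[K] := jO pO + jO qO * θ with hL
  have hLcoe : (L : K) = lam := by
    have h := congrArg Subtype.val hlamcoord
    exact h.symm
  refine ⟨uO, pO, qO, tO, DO, rfl, rfl, rfl, hLcoe, ?_, ?_, ?_, ?_⟩
  · -- `hlam2` in `𝒪[K]`
    apply Subtype.ext
    change ((L ^ 2 - jO tO * L + jO DO : 𝒪[K]) : K) = 0
    push_cast
    rw [hLcoe, hjO, hjO]
    exact hlam
  · -- `hxstar`
    change ((uO, L) : 𝒪[E] × 𝒪[K]) * (σO uO, σKO L) = 1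
    rw [Prod.mk_mul_mk, Prod.mk_eq_one]
    exact ⟨Subtype.ext (by rw [Subring.coe_mul, hσO, Subring.coe_one]; exact hσu),
      Subtype.ext (by rw [Subring.coe_mul, hσKO, hLcoe, Subring.coe_one]; exact hσlam)⟩
  · -- `hN`
    rw [hqO, hvq]; exact hb
  · -- `hn`
    have hdet : (u • (1 : Matrix (Fin 2) (Fin 2) E) - g).det = u * u - g.trace * u + g.det :=
      Literature.NumberTheory.Rogawski1990.det_smul_one_sub_eq g u
    have : ((uO * uO - tO * uO + DO : 𝒪[E]) : E) = (u • (1 : Matrix (Fin 2) (Fin 2) E) - g).det := by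
      rw [hdet]; rfl
    rw [this, hn]

end Pair

/-! ## §3 Composition with ★ (c6): the glued type-(2) order of the Eisenstein data -/

section Order

variable {F E : Type*} [Field F] [ValuativeRel F] [Field E] [ValuativeRel E] {K : Type*} [Field K] [ValuativeRel K] [Algebra E K]
  (hval : ∀ x : E, valuation K (algebraMap E K x) ≤ 1 ↔ valuation E x ≤ 1)
  (ιO : 𝒪[F] →+* 𝒪[E]) (σO : 𝒪[E] →+* 𝒪[E]) (jO : 𝒪[E] →+* 𝒪[K]) (σKO : 𝒪[K] →+* 𝒪[K]) (θ : 𝒪[K]) {aF k₀F : 𝒪[F]}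
  (σ : E →+* E) (σK : K →+* K)
  (hjO : ∀ x : 𝒪[E], ((jO x : 𝒪[K]) : K) = algebraMap E K x)
  (hσO : ∀ x : 𝒪[E], ((σO x : 𝒪[E]) : E) = σ x) (hσKO : ∀ z : 𝒪[K], ((σKO z : 𝒪[K]) : K) = σK z)
  (hσσ : ∀ x, σO (σO x) = x) (hσι : ∀ y, σO (ιO y) = ιO y) (hfixO : ∀ x, σO x = x → ∃ y, ιO y = x)
  (hιu : ∀ y, IsUnit (ιO y) → IsUnit y) (hσ₁j : ∀ x, σKO (jO x) = jO (σO x)) (hσ₁θ : σKO θ = θ)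
  (hθ : θ ^ 2 = jO (ιO aF) * θ + jO (ιO k₀F)) (haF : aF ∈ IsLocalRing.maximalIdeal 𝒪[F]) (hk₀ : k₀F ∈ IsLocalRing.maximalIdeal 𝒪[F])
  (hcoord : ∀ z : 𝒪[K], ∃! bc : 𝒪[E] × 𝒪[E], z = jO bc.1 + jO bc.2 * θ) (htr : ∃ b₀ : 𝒪[E], b₀ + σO b₀ = 1)
  {ϖF : F} {ϖ : E} (hϖF : IsUniformizingElement ϖF) (hϖ : IsUniformizingElement ϖ) (hιϖ : ιO ⟨ϖF, hϖF.mem⟩ = ⟨ϖ, hϖ.mem⟩)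
  (hk₁ : valuation E ((ιO k₀F : 𝒪[E]) : E) = valuation E ϖ)

include hval hjO hσO hσKO hσσ hσι hfixO hιu hσ₁j hσ₁θ hθ haF hk₀ hcoord htr hιϖ hk₁ in
/-- **(c5-ii-D′) THE GLUED TYPE-(2) ORDER OF THE EISENSTEIN DATA.**  Over the inert dictionary + Eisenstein letters of ★ F3-3 ∕ ★ (c5-ii) A (`ιO σO jO σKO θ`, …), from ★ (W1)'s
`hT` data and a unitary root `λ` of `χ_g` as in `exists_integralPair_of_eisensteinData`: `𝒪_E[(uO, λ)] = G(N′, n′, ιO y)` for some `y ∈ 𝒪_F` at a MONOGENIC level — EITHER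
`n′ = 2N′+1 ∧ y ∈ (ϖ_F^{N′+1})` OR `n′ = 2M`, `M ≤ N′`, `y ∈ (ϖ_F^M) ∖ (ϖ_F^{M+1})` (`M = 0` = the product-order boundary row) — by ★ (c6) `exists_coe_range_eval₂_eq_glued_map`.
F3-5b-III's rows `xR ∕ hxR ∕ cF ∕ hR ∕ hlaw` in one `obtain`. [cite: Rogawski1990, §4.9 Lemma 4.9.3 p. 56, Prop. 4.9.1 (b) p. 55] [cite: Neukirch1999, Ch. I §12] [cite: SerreLocalFields1979, Ch. I §6 Prop. 17–18] -/
theorem exists_typeTwoOrder_of_eisensteinData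
    {g Θ : Matrix (Fin 2) (Fin 2) E} {u α β a b : E} {n N : ℕ}
    (hg : ∀ i j, g i j ∈ 𝒪[E]) (hu : u ∈ 𝒪[E]) (h10 : g 1 0 ≠ 0)
    (hΘ : Θ = α • 1 + β • g) (hΘd : valuation E Θ.det = valuation E ϖ) (hΘt : valuation E Θ.trace < 1)
    (hrel : u • (1 : Matrix (Fin 2) (Fin 2) E) - g = a • 1 + b • Θ)
    (hn : valuation E (u • (1 : Matrix (Fin 2) (Fin 2) E) - g).det = valuation E ϖ ^ n) (hb : valuation E b = valuation E ϖ ^ N)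
    {lam : K} (hlam : lam ^ 2 - algebraMap E K g.trace * lam + algebraMap E K g.det = 0)
    (hσu : u * σ u = 1) (hσlam : lam * σK lam = 1) :
    ∃ (uO pO qO tO DO : 𝒪[E]) (y : 𝒪[F]), (uO : E) = u ∧ (tO : E) = g.trace ∧ (DO : E) = g.det ∧ ((jO pO + jO qO * θ : 𝒪[K]) : K) = lam ∧
      (jO pO + jO qO * θ) ^ 2 - jO tO * (jO pO + jO qO * θ) + jO DO = 0 ∧
      ((uO, jO pO + jO qO * θ) : 𝒪[E] × 𝒪[K]) * RingHom.prodMap σO σKO (uO, jO pO + jO qO * θ) = 1 ∧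
      valuation E ((qO : 𝒪[E]) : E) = valuation E ϖ ^ N ∧
      valuation E ((uO * uO - tO * uO + DO : 𝒪[E]) : E) = valuation E ϖ ^ n ∧
      ((Polynomial.eval₂RingHom (RingHom.prod (RingHom.id 𝒪[E]) jO) ((uO, jO pO + jO qO * θ) : 𝒪[E] × 𝒪[K])).range : Set (𝒪[E] × 𝒪[K])) =
        {z : 𝒪[E] × 𝒪[K] | ∃ b₀ c₀ : 𝒪[E], z.2 = jO b₀ + jO c₀ * (jO ((⟨ϖ, hϖ.mem⟩ : 𝒪[E]) ^ N) * θ) ∧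
          z.1 - (b₀ + c₀ * ιO y) ∈ Ideal.span {(⟨ϖ, hϖ.mem⟩ : 𝒪[E]) ^ n}} ∧
      ((n = 2 * N + 1 ∧ y ∈ Ideal.span {(⟨ϖF, hϖF.mem⟩ : 𝒪[F]) ^ (N + 1)}) ∨
        ∃ M : ℕ, M ≤ N ∧ n = 2 * M ∧ y ∈ Ideal.span {(⟨ϖF, hϖF.mem⟩ : 𝒪[F]) ^ M} ∧
          y ∉ Ideal.span {(⟨ϖF, hϖF.mem⟩ : 𝒪[F]) ^ (M + 1)}) := by
  have ha : ιO aF ∈ IsLocalRing.maximalIdeal 𝒪[E] := map_k₀_mem_maximalIdeal ιO hιu haF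
  obtain ⟨uO, pO, qO, tO, DO, huO, htO, hDO, hLcoe, hlam2, hxstar, hN, hn'⟩ :=
    exists_integralPair_of_eisensteinData hval jO hjO θ hθ ha hϖ hk₁ hcoord σ σK σO hσO σKO hσKO hg hu h10 hΘ hΘd hΘt hrel hn hb hlam hσu hσlam
  obtain ⟨y, hR, hlvl⟩ :=
    exists_coe_range_eval₂_eq_glued_map jO θ σO σKO ιO hσσ hσι hfixO hιu hσ₁j hσ₁θ hθ haF hk₀ hcoord htr hϖF hϖ hιϖ hk₁ hlam2 hxstar hN hn'
  exact ⟨uO, pO, qO, tO, DO, y, huO, htO, hDO, hLcoe, hlam2, hxstar, hN, hn', hR, hlvl⟩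

end Order

end Literature.NumberTheory.Automorphic

end
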